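import Summits.Ventures.PackingBounds.Energy.FivePointRieszSixGramDataL1
import Summits.Ventures.PackingBounds.Energy.FivePointRieszSixGramDataL2
import HarnessLib

/-!
# Integer Gram data `S·Y = L Lᵀ + E` (the rows of L: the table (collector of 2 part modules)) of the 158 × 158 SOS block of the exact sharp three-point certificate
# `e3pt-sharp-n3N5s6d8-none.json` (triangular bipyramid; five points on S², single SOS term, d = 8)

Framing: lottery ticket; floor = certified bounds/negative ranges. Venture `PackingBounds`, cell `pub-packcert`, energy family E3PT
(pub-packcert-energy gen 15; KERNEL-D6 data route). `yR6` = S·Y (S = `scaleR6` = lcm of denominators · 2^40), `lR6` = rounded scaled Cholesky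
factor, `eR6` = S·Y − lR6·lR6ᵀ (exact; symmetric, diagonally dominant). Checked by `decide +kernel` with `GramData.checkRows` / `checkDD`
in `FivePointRieszSixGramFacts*`; generator `pub-packcert-energy/code/e3pt/g15/e3pt_lean_n3x.py`. (Rows split in independent modules for the gate's request-size limit; one collector per table.)
-/

namespace Summit.Ventures.PackingBounds.Energy.RieszSixD8

/-- data rows. -/
def lR6 : List (List ℤ) := [lR60, lR61, lR62, lR63, lR64, lR65, lR66, lR67, lR68, lR69, lR610, lR611, lR612, lR613, lR614, lR615, lR616, lR617, lR618, lR619, lR620, lR621, lR622, lR623, lR624, lR625, lR626, lR627, lR628, lR629, lR630, lR631, lR632, lR633, lR634, lR635, lR636, lR637, lR638, lR639, lR640, lR641, lR642, lR643, lR644, lR645, lR646, lR647, lR648, lR649, lR650, lR651, lR652, lR653, lR654, lR655, lR656, lR657, lR658, lR659, lR660, lR661, lR662, lR663, lR664, lR665, lR666, lR667, lR668, lR669, lR670, lR671, lR672, lR673, lR674, lR675, lR676, lR677, lR678, lR679, lR680, lR681, lR682, lR683, lR684, lR685, lR686, lR687, lR688, lR689, lR690, lR691, lR692, lR693, lR694,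 lR695, lR696, lR697, lR698, lR699, lR6100, lR6101, lR6102, lR6103, lR6104, lR6105, lR6106, lR6107, lR6108, lR6109, lR6110, lR6111, lR6112, lR6113, lR6114, lR6115, lR6116, lR6117, lR6118, lR6119, lR6120, lR6121, lR6122, lR6123, lR6124, lR6125, lR6126, lR6127, lR6128, lR6129, lR6130, lR6131, lR6132, lR6133, lR6134, lR6135, lR6136, lR6137, lR6138, lR6139, lR6140, lR6141, lR6142, lR6143, lR6144, lR6145, lR6146, lR6147, lR6148, lR6149, lR6150, lR6151, lR6152, lR6153, lR6154, lR6155, lR6156, lR6157]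

end Summit.Ventures.PackingBounds.Energy.RieszSixD8
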